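import Summits.AtomisticToContinuum.HydrodynamicLimit.Theorems.InformationPercolationEnginePercolationClosesChaosRevealedDefectDictionaryBound
import HarnessLib

/-!
# `AtomDictionary → DefectOscDomination`: steps 5–6 of the oscillation lemma and the reduction of stub S8 to its enumeration step
(line `equilibrium-forecast-chain-rule`, crux `InformationPercolationEngine.PercolationClosesChaos`, stmt-AtomisticToContinuum-15178)

Support file (`--supports stmt-AtomisticToContinuum-15178`) of the registered stub `stub_revealedDefectStability` (worker W6 of
lead c3). `AtomDictionary` is step 1 of the paper proof of `DefectOscDomination` (`S8.audit.md` §B) as a `Prop`: two good points of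
one `seqHistLE b c σ N Φ k q`-atom are related by `OwnedTripleDictionary (2b)` (`…RevealedDefectDictionaryBound.lean`). Its
SNAPSHOT HALF (same start cells, `2b`-close step-start velocities) is proved here (`startCell_eq_and_norm_sub_le_of_seqHistLE_eq`,
`norm_sub_le_of_velBin_eq`); its COLLISION HALF `AtomCollisionDictionary` (the bijection of owned triples) is the statement the
enumeration of revealed record lists (worker W3's `sum_filter_fst_eq_sum_range`, `jumps`, `nthRecordOf`) must deliver
(`atomDictionary_of_collisionDictionary`); it is deterministic bookkeeping, NOT an assumption on the dynamics. Given it, `defectOscDomination_of_atomDictionary`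
proves the oscillation lemma: `M = max(8C/η, 1)`; the auxiliary speed threshold `V' = 32C(E₀ + E₀√E₀)/(s₀η) + 1` makes the
fast-pair term `≤ η/8`; the moduli of `Ψ` on `S² × B̄_{V+1}²` and `S² × B̄_{V'+1}²` at `η/8` (`exists_modulus_markTest`) fix the
closeness scales `t₁, t₂`; `b₀ = ½ min(1, g t₁/4, t₁, t₂, η s₀/(80C+80))`; then on every good point of the atom
`ownedCount_mul_abs_unitDefect_sub_le` bounds `owned · |Δ unitDefect|` by `4C · rough + (η/2) · owned`, so
`defectOsc ≤ 4C · rough/owned + η/2` (`Real.sSup_le`) and `min_le_max_mul_min_of_osc` gives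
`min(owned, T) 𝟙{η < defectOsc} ≤ M · min(rough, T)`. Registered headline:
`revealedDefectStability_of_atomDictionary : RoughCollisionRare → AtomDictionary → RevealedDefectStability`.
-/

noncomputable section

open MeasureTheory Set Filter Topology
open scoped ENNReal BigOperators Classical
open Literature.Analysis.FluidPDE Literature.MathematicalPhysics.KineticTheory
open Literature.MathematicalPhysics.KineticTheory.VelocityBlindPlacement

namespace Summit.AtomisticToContinuum.HydrodynamicLimit.Theorems.EquilibriumForecastLine

/-! ## Step 1: the snapshot half (proved) and the collision half (the remaining enumeration statement) -/

/-- Two velocities in the same bin of width `b` are within `2b` (each coordinate within `b`, and `√3 ≤ 2`). [folklore] -/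
theorem norm_sub_le_of_velBin_eq {b : ℝ} (hb : 0 < b) {v v' : V3} (h : velBin b v = velBin b v') : ‖v - v'‖ ≤ 2 * b := by
  have hco : ∀ m, |v m - v' m| ≤ b := by
    intro m
    have hm : ⌊v m / b⌋ = ⌊v' m / b⌋ := congrFun h m
    have h1 := Int.abs_sub_lt_one_of_floor_eq_floor hm
    rw [← sub_div, abs_div, abs_of_pos hb, div_lt_one hb] at h1
    exact h1.le
  have hsq : ‖v - v'‖ ^ 2 ≤ (2 * b) ^ 2 := by
    rw [EuclideanSpace.norm_eq, Real.sq_sqrt (Finset.sum_nonneg fun _ _ => sq_nonneg _)]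
    calc ∑ m, ‖(v - v') m‖ ^ 2 ≤ ∑ _m : Fin 3, b ^ 2 := Finset.sum_le_sum fun m _ => by
            rw [Real.norm_eq_abs, PiLp.sub_apply]
            exact pow_le_pow_left₀ (abs_nonneg _) (hco m) 2
      _ = 3 * b ^ 2 := by simp
      _ ≤ (2 * b) ^ 2 := by nlinarith [sq_nonneg b]
  exact (pow_le_pow_iff_left₀ (norm_nonneg _) (by positivity) two_ne_zero).1 hsq

/-- **Step 1 of the oscillation lemma, the snapshot half**: two good points with the same `seqHistLE b c σ N Φ k q` have the same
start cells and `2b`-close step-start velocities, sphere by sphere (the snapshot `obs k` is the last entry of the common history).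
[folklore] -/
theorem startCell_eq_and_norm_sub_le_of_seqHistLE_eq {σ : ℝ} {N : ℕ} (Φ : Flow σ N) {b : ℝ} (hb : 0 < b) (c : ℝ) (k : ℕ)
    (q : Cell) {z z' : Phase N} (hz : z ∈ Φ.good) (hz' : z' ∈ Φ.good)
    (hH : seqHistLE b c σ N Φ k q z' = seqHistLE b c σ N Φ k q z) :
    (∀ i, startCell c σ N Φ k z' i = startCell c σ N Φ k z i) ∧
      ∀ i, ‖((Φ.flow ((k : ℝ) * stepLen c σ N) z') i).2 - ((Φ.flow ((k : ℝ) * stepLen c σ N) z) i).2‖ ≤ 2 * b := by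
  have h1 := congrFun (congrArg Prod.fst hH) (Fin.last k)
  have hk : obs b c σ N Φ k z' = obs b c σ N Φ k z := by
    simp only [seqHistLE, hist, Fin.val_last] at h1
    exact h1
  have hobs : ∀ i, (cellOf c σ N ((Φ.flow ((k : ℝ) * stepLen c σ N) z') i).1,
        velBin b ((Φ.flow ((k : ℝ) * stepLen c σ N) z') i).2) =
      (cellOf c σ N ((Φ.flow ((k : ℝ) * stepLen c σ N) z) i).1, velBin b ((Φ.flow ((k : ℝ) * stepLen c σ N) z) i).2) := by
    intro i
    have h := congrFun hk i
    unfold obs at h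
    rw [if_pos hz', if_pos hz] at h
    exact congrArg Prod.fst h
  refine ⟨fun i => ?_, fun i => ?_⟩
  · exact congrArg Prod.fst (hobs i)
  · exact norm_sub_le_of_velBin_eq hb (congrArg Prod.snd (hobs i))

/-- **The collision-level dictionary of revealed atoms** (step 1 of the oscillation lemma as ONE statement): two good points of one
`seqHistLE b c σ N Φ k q`-atom are related by `OwnedTripleDictionary (2b)` — same start cells, `2b`-close step-start velocities
(the snapshot half, `startCell_eq_and_norm_sub_le_of_seqHistLE_eq`) and a label-preserving correspondence of their `q`-owned
collision triples with `2b`-close pre-collisional velocities and `4b`-close kicks (the collision half, `AtomCollisionDictionary`;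
`atomDictionary_of_collisionDictionary`). Deterministic bookkeeping, NOT an assumption on the dynamics. -/
def AtomDictionary : Prop :=
  ∀ {σ : ℝ} {N : ℕ} (Φ : Flow σ N) (b c : ℝ) (k : ℕ) (q : Cell) {z z' : Phase N}, 0 < σ → σ < 2⁻¹ → 0 < c → 0 < b →
    z ∈ Φ.good → z' ∈ Φ.good → seqHistLE b c σ N Φ k q z' = seqHistLE b c σ N Φ k q z →
    OwnedTripleDictionary Φ (2 * b) c k q z z'

/-- **The collision half of step 1** (the statement the enumeration of revealed record lists must deliver — worker W3's index
correspondence `sum_filter_fst_eq_sum_range` read through `nthRecordOf`): for two good points of one `seqHistLE b c σ N Φ k q`-atom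
there is a map `Θ`, a bijection from the `q`-owned collision triples of step `k` of `z` onto those of `z'`, preserving the ordered
labels, with `2b`-close pre-collisional velocities of both members and `4b`-close kicks of the first member (equal record lists of
the member starting in `q`: same partner label, same bins of its own pre/post velocity and of the partner's pre-velocity; the kick of
the other member is the opposite one, `reflectVel_fst_add_reflectVel_snd`, and `markOf_swap` exchanges the slots). -/
def AtomCollisionDictionary : Prop :=
  ∀ {σ : ℝ} {N : ℕ} (Φ : Flow σ N) (b c : ℝ) (k : ℕ) (q : Cell) {z z' : Phase N}, 0 < σ → σ < 2⁻¹ → 0 < c → 0 < b →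
    z ∈ Φ.good → z' ∈ Φ.good → seqHistLE b c σ N Φ k q z' = seqHistLE b c σ N Φ k q z →
    ∃ Θ : ℝ × Fin (N + 1) × Fin (N + 1) → ℝ × Fin (N + 1) × Fin (N + 1),
      Set.BijOn Θ
        {e | e ∈ collTriples Φ (stepWindow c σ N k) z ∧
          cellMin (startCell c σ N Φ k z e.2.1) (startCell c σ N Φ k z e.2.2) = q}
        {e | e ∈ collTriples Φ (stepWindow c σ N k) z' ∧
          cellMin (startCell c σ N Φ k z' e.2.1) (startCell c σ N Φ k z' e.2.2) = q} ∧
      ∀ e, e ∈ collTriples Φ (stepWindow c σ N k) z →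
        cellMin (startCell c σ N Φ k z e.2.1) (startCell c σ N Φ k z e.2.2) = q →
        (Θ e).2 = e.2 ∧
        ‖(markOf N (hsDiameter σ N) (Φ.flow e.1 z) e.2.1 e.2.2).2.1 -
            (markOf N (hsDiameter σ N) (Φ.flow (Θ e).1 z') e.2.1 e.2.2).2.1‖ ≤ 2 * b ∧
        ‖(markOf N (hsDiameter σ N) (Φ.flow e.1 z) e.2.1 e.2.2).2.2 -
            (markOf N (hsDiameter σ N) (Φ.flow (Θ e).1 z') e.2.1 e.2.2).2.2‖ ≤ 2 * b ∧
        ‖(((Φ.flow e.1 z) e.2.1).2 - (markOf N (hsDiameter σ N) (Φ.flow e.1 z) e.2.1 e.2.2).2.1) -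
            (((Φ.flow (Θ e).1 z') e.2.1).2 - (markOf N (hsDiameter σ N) (Φ.flow (Θ e).1 z') e.2.1 e.2.2).2.1)‖ ≤ 2 * (2 * b)

/-- The snapshot half is proved, so the collision half gives the whole dictionary. [folklore] -/
theorem atomDictionary_of_collisionDictionary (h : AtomCollisionDictionary) : AtomDictionary := by
  intro σ N Φ b c k q z z' hσ hσ2 hc hb hz hz' hH
  obtain ⟨hcell, hvel⟩ := startCell_eq_and_norm_sub_le_of_seqHistLE_eq Φ hb c k q hz hz' hH
  obtain ⟨Θ, hΘ, hΘe⟩ := h Φ b c k q hσ hσ2 hc hb hz hz' hH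
  exact ⟨hcell, hvel, Θ, hΘ, hΘe⟩

/-! ## Steps 5–6: `AtomDictionary → DefectOscDomination`, and the reduction of S8 to its enumeration step -/

/-- **`AtomDictionary → DefectOscDomination`** (steps 2–6 of the oscillation lemma, given step 1): the constant is
`M = max(8C/η, 1)`; `V'` is chosen to make the fast-pair term `≤ η/8`, the two moduli of `Ψ` (`exists_modulus_markTest` on
`S² × B̄_{V+1}²` and `S² × B̄_{V'+1}²` at `η/8`) fix the closeness scale, and `b₀` makes `β = 2b` smaller than every scale and the
`10Cβ/s₀` term `≤ η/8`; then `ownedCount_mul_abs_unitDefect_sub_le` on each good point of the atom bounds `defectOsc` by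
`4C · rough/owned + η/2` (`Real.sSup_le`) and `min_le_max_mul_min_of_osc` concludes. [folklore] -/
theorem defectOscDomination_of_atomDictionary (hAD : AtomDictionary) : DefectOscDomination := by
  intro Ψ hΨc C hΨ η hη
  have hC : 0 ≤ C := (abs_nonneg _).trans (hΨ 0)
  refine ⟨max (8 * C / η) 1, by positivity, ?_⟩
  intro T g V s₀ E₀ hT hg hV hs₀ hE₀
  -- the two moduli of `Ψ` and the auxiliary speed threshold
  obtain ⟨t₁, ht₁, hmod₁⟩ := exists_modulus_markTest hΨc (V + 1) (ε := η / 8) (by positivity)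
  set V' : ℝ := 32 * C * (E₀ + E₀ * Real.sqrt E₀) / (s₀ * η) + 1 with hV'def
  have hV'1 : 1 ≤ V' := by
    have h0 : 0 ≤ 32 * C * (E₀ + E₀ * Real.sqrt E₀) / (s₀ * η) := by positivity
    rw [hV'def]
    linarith
  have hV' : 0 < V' := by linarith
  obtain ⟨t₂, ht₂, hmod₂⟩ := exists_modulus_markTest hΨc (V' + 1) (ε := η / 8) (by positivity)
  -- the bin width
  set β₀ : ℝ := min (min 1 (g * t₁ / 4)) (min (min t₁ t₂) (η * s₀ / (80 * C + 80))) with hβ₀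
  have hβ₀pos : 0 < β₀ := by rw [hβ₀]; positivity
  refine ⟨β₀ / 2, by positivity, ?_⟩
  intro σ N Φ c b hσ hσ2 hc hb hbβ z hz k q
  set β : ℝ := 2 * b with hβdef
  have hβ0 : 0 ≤ β := by positivity
  have hββ₀ : β ≤ β₀ := by rw [hβdef]; linarith
  have hβ1 : β ≤ 1 := hββ₀.trans ((min_le_left _ _).trans (min_le_left _ _))
  have hβg : β ≤ g * t₁ / 4 := hββ₀.trans ((min_le_left _ _).trans (min_le_right _ _))
  have hβt₁ : β ≤ t₁ := hββ₀.trans ((min_le_right _ _).trans ((min_le_left _ _).trans (min_le_left _ _)))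
  have hβt₂ : β ≤ t₂ := hββ₀.trans ((min_le_right _ _).trans ((min_le_left _ _).trans (min_le_right _ _)))
  have hβη : β ≤ η * s₀ / (80 * C + 80) := hββ₀.trans ((min_le_right _ _).trans (min_le_right _ _))
  have hs4 : 4 * β / g ≤ t₁ := by
    rw [div_le_iff₀ hg]; nlinarith
  -- the moduli in the shapes the assembly consumes
  have hmod₁' : ∀ (ω ω' a b' a' b'' : V3), ‖ω‖ = 1 → ‖ω'‖ = 1 → ‖a‖ ≤ V + 1 → ‖b'‖ ≤ V + 1 → ‖a'‖ ≤ V + 1 →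
      ‖b''‖ ≤ V + 1 → ‖ω - ω'‖ ≤ t₁ → ‖a - a'‖ ≤ t₁ → ‖b' - b''‖ ≤ t₁ → |Ψ (ω, a, b') - Ψ (ω', a', b'')| ≤ η / 8 :=
    hmod₁
  have hmod₂' : ∀ (ω : Metric.sphere (0 : V3) 1) (a b' a' b'' : V3), ‖a‖ ≤ V' → ‖b'‖ ≤ V' → ‖a' - a‖ ≤ β → ‖b'' - b'‖ ≤ β →
      |Ψ ((ω : V3), a, b') - Ψ ((ω : V3), a', b'')| ≤ η / 8 := by
    intro ω a b' a' b'' ha hb ha' hb'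
    have hω : ‖(ω : V3)‖ = 1 := norm_coe_unitSphere ω
    refine hmod₂ ω ω a b' a' b'' hω hω (by linarith) (by linarith) ?_ ?_ (by rw [sub_self, norm_zero]; exact ht₂.le)
      ?_ ?_
    · have := norm_le_norm_add_norm_sub' a' a  -- ‖a'‖ ≤ ‖a‖ + ‖a' - a‖
      linarith
    · have := norm_le_norm_add_norm_sub' b'' b'
      linarith
    · rw [norm_sub_rev]; exact ha'.trans hβt₂
    · rw [norm_sub_rev]; exact hb'.trans hβt₂
  -- the fast-pair term
  have hX : 4 * C * (E₀ / V' + E₀ * Real.sqrt E₀ / V' ^ 2) / s₀ ≤ η / 8 := by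
    have h1 : E₀ / V' + E₀ * Real.sqrt E₀ / V' ^ 2 ≤ (E₀ + E₀ * Real.sqrt E₀) / V' := by
      rw [add_div]
      have h2 : E₀ * Real.sqrt E₀ / V' ^ 2 ≤ E₀ * Real.sqrt E₀ / V' :=
        div_le_div_of_nonneg_left (by positivity) hV' (by nlinarith)
      linarith
    have h3 : 4 * C * ((E₀ + E₀ * Real.sqrt E₀) / V') / s₀ ≤ η / 8 := by
      rw [mul_div_assoc', div_div, div_le_iff₀ (by positivity)]
      have h4 : 32 * C * (E₀ + E₀ * Real.sqrt E₀) / (s₀ * η) ≤ V' := by rw [hV'def]; linarith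
      rw [div_le_iff₀ (by positivity)] at h4
      nlinarith
    calc 4 * C * (E₀ / V' + E₀ * Real.sqrt E₀ / V' ^ 2) / s₀ ≤ 4 * C * ((E₀ + E₀ * Real.sqrt E₀) / V') / s₀ := by
          gcongr
      _ ≤ η / 8 := h3
  have h10 : 10 * C * β / s₀ ≤ η / 8 := by
    rw [div_le_iff₀ hs₀]
    have h := hβη
    rw [le_div_iff₀ (by positivity)] at h
    nlinarith
  -- the case of a unit owning no collision
  have hown0 := ownedCount_nonneg hc.le hσ Φ k q z
  have hr0 := roughOwnedCount_nonneg Φ hc.le hσ g V s₀ E₀ k q z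
  have hM0 : 0 ≤ max (8 * C / η) 1 := by positivity
  by_cases hev : η < defectOsc Ψ b c σ N Φ k q z
  swap
  · rw [if_neg hev, mul_zero]; positivity
  rw [if_pos hev, mul_one]
  rcases hown0.eq_or_lt with h0 | hpos
  · rw [← h0, min_eq_left hT.le]
    positivity
  -- the oscillation bound on the atom
  have hosc : defectOsc Ψ b c σ N Φ k q z ≤
      4 * C * roughOwnedCount g V s₀ E₀ c σ N Φ k q z / ownedCount c σ N Φ k q z + η / 2 := by
    unfold defectOsc
    refine Real.sSup_le ?_ (by positivity)
    rintro _ ⟨z', ⟨hz', hat⟩, rfl⟩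
    have hdict : OwnedTripleDictionary Φ β c k q z z' := hAD Φ b c k q hσ hσ2 hc hb hz hz' hat
    have main := ownedCount_mul_abs_unitDefect_sub_le Φ hz hz' hσ hΨc hΨ hc k q hβ0 hβ1 hg hs₀ hE₀.le hV' hs4 hβt₁
      (by positivity : (0 : ℝ) ≤ η / 8) (by positivity : (0 : ℝ) ≤ η / 8) hmod₁' hmod₂' hdict
    -- divide by the owned count and bound the tail by `η/2`
    rw [← sub_le_iff_le_add, le_div_iff₀ hpos]
    have htail : (η / 8 + (η / 8 + 4 * C * (E₀ / V' + E₀ * Real.sqrt E₀ / V' ^ 2) / s₀ + 10 * C * β / s₀)) *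
        ownedCount c σ N Φ k q z ≤ η / 2 * ownedCount c σ N Φ k q z :=
      mul_le_mul_of_nonneg_right (by linarith) hown0
    have habs : ownedCount c σ N Φ k q z * (|unitDefect Ψ c σ N Φ k q z' - unitDefect Ψ c σ N Φ k q z| - η / 2) ≤
        4 * C * roughOwnedCount g V s₀ E₀ c σ N Φ k q z := by
      rw [mul_sub]; linarith
    linarith [habs, mul_comm (ownedCount c σ N Φ k q z) (|unitDefect Ψ c σ N Φ k q z' - unitDefect Ψ c σ N Φ k q z| - η / 2)]
  exact min_le_max_mul_min_of_osc hpos hr0 hT.le hη hev hosc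

/-- **Registered headline `revealedDefectStability_of_atomDictionary`: `RevealedDefectStability` from the LG-side item
`RoughCollisionRare` and the collision-level dictionary of revealed atoms `AtomDictionary`** — the deterministic oscillation lemma
is now reduced to its step 1 (`defectOscDomination_of_atomDictionary`), and the landed composition
`revealedDefectStability_of_roughCollisionRare` does the rest. [folklore] -/
theorem revealedDefectStability_of_atomDictionary : RoughCollisionRare → AtomDictionary → RevealedDefectStability := by
  intro hR hAD
  exact revealedDefectStability_of_roughCollisionRare hR (defectOscDomination_of_atomDictionary hAD)


/-- `RevealedDefectStability` from the LG-side item and the COLLISION HALF of the dictionary alone. [folklore] -/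
theorem revealedDefectStability_of_atomCollisionDictionary (hR : RoughCollisionRare) (h : AtomCollisionDictionary) :
    RevealedDefectStability :=
  revealedDefectStability_of_atomDictionary hR (atomDictionary_of_collisionDictionary h)

end Summit.AtomisticToContinuum.HydrodynamicLimit.Theorems.EquilibriumForecastLine

end
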